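import Summits.QuantumFields.BalabanUV.T4Continuum.Support.RegionGaugeCheckerboardField
import Summits.QuantumFields.BalabanUV.T4Continuum.Support.RegionStarLineGaugeRegion

/-!
# `BalabanUV.T4Continuum.Support.RegionGaugeCheckerboardPaths` — NE2 (node U1a) formalisation swarm, sub-row `T4-U1a.S-NE2-D1-DIRICHLET°`
# (vector layer, W1), FINDING F-ne2leaf09g9-1: THE SHELL PATHS OF THE CHECKERBOARD REGION — `n·n^{d−2}` bond-disjoint L-shaped lattice
# paths from the block `w` to its diagonal neighbour `w′ = w + e + e_ν` through the block `w + e`; along each, the residual of ANY Dirichlet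
# gauge of the test field telescopes to `n`, so the path of `2r + 2` bonds carries residual energy `≥ n²/(3(r+1))`
# (unit b2b-balaban-t4-ne2-formalise-leaf-09, gen 9, v1)

HONEST FRAMING (T4-DAG p. 1).  [folklore] `U = 1`, model level, the one region family of `RegionGaugeCheckerboardField`; lattice path
bookkeeping towards the located NO-GO of the sequel `RegionGaugeCheckerboardNoGo`; nothing printed is a hypothesis; NE2 (U1a) NOT proved; spine
PROVED 0/9 unchanged; NOT [B9] (3.23)–(3.27) as printed; NOT infinite volume, NOT the mass gap, NOT Clay.  HONEST DEPENDENCY (verbatim):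
«continuum YM on T⁴ ⇐ BetaPertH ∧ nine spine estimates (0/9 proved); BetaPertH ⇐ (D1) ∧ (D4) ∧ CAP+tail; G-an2-4 gates asym, D1 and NE2/3/4.»

WHAT THIS FILE PROVES (0 sorry).  Paths are indexed by a digit vector `j` (only `j₀ = j[ν ↦ 0]` matters; `r = j_e` is the shell index):
`start j` (in `w`, `e`-digit `n−1`, `ν`-digit `n−1−r`) →ᵉ `base j` (in `w + e`, digits `(0, n−1−r)`) →ᵉ … →ᵉ `corner j` (digits `(r, n−1−r)`)
→ᵛ … →ᵛ `fin j = n·w′ + j₀` (`r` horizontal bonds, `r + 1` vertical bonds, one entry bond).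
 * §1 the sites and their blocks (`blockOf_start`, `blockOf_base_add`, `blockOf_corner_add`, `blockOf_fin`), the joints (`start_add_unitVec`,
   `base_add_tstep`, `corner_add_tstep`).
 * §2 the residual `G μ = ext (testField − ∂_Ω μ)` of a Dirichlet gauge on the torus; on every star bond `G μ (x, μ′) = n·(φ(x + e_{μ′}) − φ(x))`,
   `φ = 1_{w′} − ext μ` (`G_apply_of_star`); `nsq (testField − gradR μ) = nsq (G μ)`.
 * §3 TELESCOPING: entry + horizontal + vertical residuals sum to `n·(φ(fin) − φ(start)) = n` (`path_sum_eq`).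
 * §4 THE PER-PATH BOUND **`pathEnergy_ge`**: `pathEnergy μ j ≥ n²/(3(r+1))` (Cauchy–Schwarz on the three pieces).

ABSOLUTE RULE (cell, verbatim): «No internally-minted statement may enter as a cited fact. Every hypothesis is either kernel-proved in
this package or a verbatim quotation of a PUBLISHED theorem with page reference. The manuscript(s) under audit are NOT citable for
their own disputed steps — they are the thing under adjudication; programme-internal (2001/route/tribunal) claims are never citable.»
[folklore] throughout; data defs `jz`, `shell`, `start`, `base`, `corner`, `fin`, `G`, `pathEnergy`; no `def … : Prop`.  NOT CLAIMED: the
no-go (sequel); NE2; NE3.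
-/

noncomputable section

open scoped BigOperators ComplexConjugate Matrix
open Finset

namespace Summit.QuantumFields.BalabanUV.T4Continuum.RegionGaugeCheckerboardPaths

open Literature.MathematicalPhysics.QuantumFieldTheory.Balaban1983to89.B5Prop11Plancherel (Tor fine unitVec)
open Literature.MathematicalPhysics.QuantumFieldTheory.Balaban1983to89.B5Prop11Lower (nsq nsq_nonneg)
open Literature.MathematicalPhysics.QuantumFieldTheory.Balaban1983to89.B5Action121 (GradOp GradOp_mulVec sdiff_mulVec)
open Literature.MathematicalPhysics.QuantumFieldTheory.Balaban1983to89.B5Block118 (bpt tstep tstep_zero tstep_succ bpt_add_tstep)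
open Literature.MathematicalPhysics.QuantumFieldTheory.Balaban1983to89.B5Blocks16 (blockOf blockOf_bpt)
open Summit.QuantumFields.BalabanUV.T4Continuum
open Summit.QuantumFields.BalabanUV.T4Continuum.SubtypeCompression (ext ext_apply_of ext_apply_of_not nsq_ext)
open Summit.QuantumFields.BalabanUV.T4Continuum.ScalarBlockTrialFunction (bpt_add_unitVec_of_eq)
open Summit.QuantumFields.BalabanUV.T4Continuum.RegionGaugeFixedVector (starReg curlR gradR avgR)
open Summit.QuantumFields.BalabanUV.T4Continuum.RegionStarLineGauge (tstep_add lastD)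
open Summit.QuantumFields.BalabanUV.T4Continuum.RegionStarLineGaugeRegion (norm_sum_range_sq_le)
open Summit.QuantumFields.BalabanUV.T4Continuum.RegionGaugeCheckerboardField
open Summit.QuantumFields.BalabanUV.Beta.GAN24.DirichletBoxTrace (blockReg bpt_update_add_tstep bpt_eq_update_add)

variable {d : ℕ} (n : ℕ) [NeZero n] (M : Fin d → ℕ) [hM : ∀ μ, NeZero (M μ)] (w : Tor M) (e ν : Fin d)

/-! ## §1 The shell paths -/

/-- the block through which the shells run: `v = w + e`. [folklore] -/
def vb : Tor M := w + unitVec M e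

/-- the path index with its `ν`-digit reset: `j₀ = j[ν ↦ 0]`. [folklore] -/
def jz (j : Fin d → Fin n) : Fin d → Fin n := Function.update j ν 0

/-- the shell index `r = j_e`. [folklore] -/
def shell (j : Fin d → Fin n) : ℕ := (j e : ℕ)

omit [NeZero n] in
/-- `r < n`. [folklore] -/
theorem shell_lt (j : Fin d → Fin n) : shell n e j < n := (j e).isLt

/-- the height of shell `r`: the digit `n − 1 − r`. [folklore] -/
def height (j : Fin d → Fin n) : Fin n := ⟨n - 1 - shell n e j, by have := shell_lt n e j; omega⟩

/-- the ENTRY SITE in `w`: `e`-digit `n − 1`, `ν`-digit `n − 1 − r`. [folklore] -/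
def start (j : Fin d → Fin n) : Tor (fine n M) :=
  bpt n M w (Function.update (jz n ν j) e (lastD n)) + tstep (fine n M) ν (height n e j : ℕ)

/-- the FIRST SITE of the horizontal run in `w + e`: digits `(0, n − 1 − r)`. [folklore] -/
def base (j : Fin d → Fin n) : Tor (fine n M) :=
  bpt n M (vb M w e) (Function.update (jz n ν j) e 0) + tstep (fine n M) ν (height n e j : ℕ)

/-- the CORNER of the shell: digits `(r, n − 1 − r)`. [folklore] -/
def corner (j : Fin d → Fin n) : Tor (fine n M) := bpt n M (vb M w e) (jz n ν j) + tstep (fine n M) ν (height n e j : ℕ)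

/-- the EXIT SITE in `w′`: `n·w′ + j₀`. [folklore] -/
def fin (j : Fin d → Fin n) : Tor (fine n M) := bpt n M (wp M w e ν) (jz n ν j)

variable {M w e ν}

omit hM in
/-- `j₀_ν = 0`. [folklore] -/
theorem jz_nu (j : Fin d → Fin n) : jz n ν j ν = 0 := by simp [jz]

omit hM in
/-- `j₀_e = j_e` (`e ≠ ν`). [folklore] -/
theorem jz_e (hne : e ≠ ν) (j : Fin d → Fin n) : jz n ν j e = j e := by simp [jz, Function.update_of_ne hne]

omit hM in
/-- resetting the `ν`-digit of a vector whose `ν`-digit is already `0`. [folklore] -/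
theorem update_nu_jz (K : Fin d → Fin n) (hK : K ν = 0) : Function.update K ν 0 = K := by
  rw [← hK, Function.update_eq_self]

omit hM in
/-- a block point with `ν`-digit `0`, moved `l < n` steps along `ν`, is the block point with `ν`-digit `l`. [folklore] -/
theorem bpt_add_tstep_nu (y : Tor M) {K : Fin d → Fin n} (hK : K ν = 0) (l : Fin n) :
    bpt n M y K + tstep (fine n M) ν (l : ℕ) = bpt n M y (Function.update K ν l) := by
  rw [← bpt_update_add_tstep n M y K ν l, update_nu_jz n K hK]

/-- `start ∈ w`. [folklore] -/
theorem blockOf_start (hne : e ≠ ν) (j : Fin d → Fin n) : blockOf n M (start n M w e ν j) = w := by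
  unfold start
  rw [bpt_add_tstep_nu n _ (by rw [Function.update_of_ne (Ne.symm hne)]; exact jz_nu n j), blockOf_bpt]

/-- the horizontal sites `base + i·e`, `i < n`, lie in `w + e`. [folklore] -/
theorem blockOf_base_add (hne : e ≠ ν) (j : Fin d → Fin n) {i : ℕ} (hi : i < n) :
    blockOf n M (base n M w e ν j + tstep (fine n M) e i) = vb M w e := by
  unfold base
  rw [add_right_comm, bpt_update_add_tstep n M _ _ e ⟨i, hi⟩,
    bpt_add_tstep_nu n _ (by rw [Function.update_of_ne (Ne.symm hne)]; exact jz_nu n j), blockOf_bpt]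

/-- the vertical sites `corner + m·e_ν`, `m ≤ r`, lie in `w + e`. [folklore] -/
theorem blockOf_corner_add (j : Fin d → Fin n) {m : ℕ} (hm : m ≤ shell n e j) :
    blockOf n M (corner n M w e ν j + tstep (fine n M) ν m) = vb M w e := by
  have hr := shell_lt n e j
  have hl : n - 1 - shell n e j + m < n := by omega
  unfold corner
  rw [add_assoc, ← tstep_add]
  have hh : (height n e j : ℕ) + m = ((⟨n - 1 - shell n e j + m, hl⟩ : Fin n) : ℕ) := rfl
  rw [hh, bpt_add_tstep_nu n _ (jz_nu n j), blockOf_bpt]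

/-- `fin ∈ w′`. [folklore] -/
theorem blockOf_fin (j : Fin d → Fin n) : blockOf n M (fin n M w e ν j) = wp M w e ν := blockOf_bpt n M _ _

omit hM in
/-- the entry bond ends at `base`: `start + e = base`. [folklore] -/
theorem start_add_unitVec (j : Fin d → Fin n) : start n M w e ν j + unitVec (fine n M) e = base n M w e ν j := by
  unfold start base vb
  rw [add_right_comm, bpt_add_unitVec_of_eq n M w _ e (by rw [Function.update_self]; exact Nat.sub_add_cancel (Nat.pos_of_ne_zero (NeZero.ne n))),
    Function.update_idem]

omit hM in
/-- the horizontal run ends at the corner: `base + r·e = corner`. [folklore] -/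
theorem base_add_tstep (hne : e ≠ ν) (j : Fin d → Fin n) : base n M w e ν j + tstep (fine n M) e (shell n e j) = corner n M w e ν j := by
  unfold base corner shell
  rw [add_right_comm, ← jz_e n hne j, ← bpt_eq_update_add n M _ (jz n ν j) e]

omit hM in
/-- the vertical run ends in `w′`: `corner + (r+1)·e_ν = fin`. [folklore] -/
theorem corner_add_tstep (j : Fin d → Fin n) : corner n M w e ν j + tstep (fine n M) ν (shell n e j + 1) = fin n M w e ν j := by
  have hr := shell_lt n e j
  unfold corner fin wp vb
  rw [add_assoc, ← tstep_add, show (height n e j : ℕ) + (shell n e j + 1) = n by simp [height]; omega, bpt_add_tstep, add_assoc]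

/-! ## §2 The residual of a Dirichlet gauge on the torus -/

/-- the residual of a Dirichlet gauge `μ` of the test field, extended by zero to all bonds. [folklore] -/
def G (μ : {x // blockReg n M (checker M w e ν) x} → ℂ) : Tor (fine n M) × Fin d → ℂ :=
  ext (starReg n M (checker M w e ν)) (testField n M w e ν - gradR n M (checker M w e ν) *ᵥ μ)

/-- the Dirichlet datum `φ = 1_{w′} − ext μ`. [folklore] -/
def phi (μ : {x // blockReg n M (checker M w e ν) x} → ℂ) : Tor (fine n M) → ℂ :=
  blockInd n M w e ν - ext (blockReg n M (checker M w e ν)) μ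

/-- `nsq (testField − ∂_Ω μ) = nsq (G μ)`. [folklore] -/
theorem nsq_G (μ : {x // blockReg n M (checker M w e ν) x} → ℂ) : nsq (testField n M w e ν - gradR n M (checker M w e ν) *ᵥ μ) = nsq (G n μ) :=
  (nsq_ext _ _).symm

/-- on a star bond the residual is the gradient of `φ`: `G μ (x, μ′) = n·(φ(x + e_{μ′}) − φ(x))`. [folklore] -/
theorem G_apply_of_star (μ : {x // blockReg n M (checker M w e ν) x} → ℂ) {x : Tor (fine n M)} {μ' : Fin d}
    (hb : starReg n M (checker M w e ν) (x, μ')) :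
    G n μ (x, μ') = (n : ℂ) * (phi n μ (x + unitVec (fine n M) μ') - phi n μ x) := by
  rw [G, ext_apply_of (starReg n M (checker M w e ν)) _ ⟨(x, μ'), hb⟩, sub_gradR_eq, GradOp_mulVec, sdiff_mulVec, phi]

omit hM in
/-- the block `w + e` belongs to the region (`2 ≤ M e`, `2 ≤ M ν`, `e ≠ ν`). [folklore] -/
theorem vb_mem (hMe : 2 ≤ M e) (hMν : 2 ≤ M ν) (hne : e ≠ ν) : checker M w e ν (vb M w e) := by
  refine ⟨fun h => ?_, fun h => ?_⟩
  · have h1 := congrFun h e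
    simp only [vb, Pi.add_apply, unitVec, Pi.single_eq_same] at h1
    exact one_ne_zero_of_two_le hMe ((add_eq_left).mp h1)
  · have h1 := congrFun h ν
    simp only [vb, wp, Pi.add_apply, unitVec, Pi.single_eq_same, Pi.single_eq_of_ne hne.symm, add_zero] at h1
    exact one_ne_zero_of_two_le hMν (by simpa using h1.symm)

/-- a bond starting in `w + e` is a star bond … [folklore] -/
theorem star_of_blockOf_vb (hMe : 2 ≤ M e) (hMν : 2 ≤ M ν) (hne : e ≠ ν) {x : Tor (fine n M)} (hx : blockOf n M x = vb M w e) (μ' : Fin d) :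
    starReg n M (checker M w e ν) (x, μ') :=
  Or.inl (show checker M w e ν (blockOf n M x) by rw [hx]; exact vb_mem hMe hMν hne)

/-- … and so is a bond ending in `w + e`. [folklore] -/
theorem star_of_blockOf_add_vb (hMe : 2 ≤ M e) (hMν : 2 ≤ M ν) (hne : e ≠ ν) {x : Tor (fine n M)} {μ' : Fin d}
    (hx : blockOf n M (x + unitVec (fine n M) μ') = vb M w e) : starReg n M (checker M w e ν) (x, μ') :=
  Or.inr (show checker M w e ν (blockOf n M (x + unitVec (fine n M) μ')) by rw [hx]; exact vb_mem hMe hMν hne)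

/-! ## §3 Telescoping along a shell path -/

/-- telescoping of `G` along a straight run of star bonds from `b₀` in direction `μ′`. [folklore] -/
theorem sum_G_run (μ : {x // blockReg n M (checker M w e ν) x} → ℂ) (b₀ : Tor (fine n M)) (μ' : Fin d) (k : ℕ)
    (hstar : ∀ i < k, starReg n M (checker M w e ν) (b₀ + tstep (fine n M) μ' i, μ')) :
    ∑ i ∈ range k, G n μ (b₀ + tstep (fine n M) μ' i, μ')
      = (n : ℂ) * (phi n μ (b₀ + tstep (fine n M) μ' k) - phi n μ b₀) := by
  have h : ∀ i ∈ range k, G n μ (b₀ + tstep (fine n M) μ' i, μ')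
      = (n : ℂ) * (phi n μ (b₀ + tstep (fine n M) μ' (i + 1)) - phi n μ (b₀ + tstep (fine n M) μ' i)) := by
    intro i hi
    rw [G_apply_of_star n μ (hstar i (mem_range.mp hi)), tstep_succ, add_assoc]
  rw [sum_congr rfl h, ← mul_sum, sum_range_sub (fun i => phi n μ (b₀ + tstep (fine n M) μ' i)) k, tstep_zero, add_zero]

/-- **THE PATH SUM**: entry residual + horizontal run + vertical run `= n·(φ(fin) − φ(start)) = n`. [folklore] -/
theorem path_sum_eq (hMe : 2 ≤ M e) (hMν : 2 ≤ M ν) (hne : e ≠ ν) (μ : {x // blockReg n M (checker M w e ν) x} → ℂ) (j : Fin d → Fin n) :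
    G n μ (start n M w e ν j, e)
      + ∑ i ∈ range (shell n e j), G n μ (base n M w e ν j + tstep (fine n M) e i, e)
      + ∑ m ∈ range (shell n e j + 1), G n μ (corner n M w e ν j + tstep (fine n M) ν m, ν) = (n : ℂ) := by
  have hr := shell_lt n e j
  have hb0 : blockOf n M (start n M w e ν j + unitVec (fine n M) e) = vb M w e := by
    have hb : blockOf n M (base n M w e ν j + tstep (fine n M) e 0) = vb M w e := blockOf_base_add n hne j (Nat.pos_of_ne_zero (NeZero.ne n))
    rwa [tstep_zero, add_zero, ← start_add_unitVec] at hb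
  have h0 : G n μ (start n M w e ν j, e) = (n : ℂ) * (phi n μ (base n M w e ν j) - phi n μ (start n M w e ν j)) := by
    rw [G_apply_of_star n μ (star_of_blockOf_add_vb n hMe hMν hne hb0), start_add_unitVec]
  have h1 := sum_G_run n μ (base n M w e ν j) e (shell n e j)
    (fun i hi => star_of_blockOf_vb n hMe hMν hne (blockOf_base_add n hne j (by omega)) e)
  have h2 := sum_G_run n μ (corner n M w e ν j) ν (shell n e j + 1)
    (fun m hm => star_of_blockOf_vb n hMe hMν hne (blockOf_corner_add n j (by omega)) ν)
  rw [base_add_tstep n hne] at h1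
  rw [corner_add_tstep] at h2
  have hs : phi n μ (start n M w e ν j) = 0 := phi_on_w n hMe hne μ (blockOf_start n hne j)
  have hf : phi n μ (fin n M w e ν j) = 1 := phi_on_wp n μ (blockOf_fin n j)
  rw [h0, h1, h2, hs, hf]
  ring

/-! ## §4 The per-path energy bound -/

/-- the RESIDUAL ENERGY carried by the shell path of `j`. [folklore] -/
def pathEnergy (μ : {x // blockReg n M (checker M w e ν) x} → ℂ) (j : Fin d → Fin n) : ℝ :=
  ‖G n μ (start n M w e ν j, e)‖ ^ 2
    + ∑ i ∈ range (shell n e j), ‖G n μ (base n M w e ν j + tstep (fine n M) e i, e)‖ ^ 2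
    + ∑ m ∈ range (shell n e j + 1), ‖G n μ (corner n M w e ν j + tstep (fine n M) ν m, ν)‖ ^ 2

/-- `0 ≤ pathEnergy`. [folklore] -/
theorem pathEnergy_nonneg (μ : {x // blockReg n M (checker M w e ν) x} → ℂ) (j : Fin d → Fin n) : 0 ≤ pathEnergy n μ j := by
  unfold pathEnergy; positivity

/-- **THE PER-PATH BOUND**: `n² ≤ 3(r+1)·pathEnergy μ j` — every shell path carries residual energy `≥ n²/(3(r+1))`, whatever the Dirichlet
gauge `μ` (the telescoped value `n` spread over `2r + 2` bonds by Cauchy–Schwarz). [folklore] -/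
theorem pathEnergy_ge (hMe : 2 ≤ M e) (hMν : 2 ≤ M ν) (hne : e ≠ ν) (μ : {x // blockReg n M (checker M w e ν) x} → ℂ) (j : Fin d → Fin n) :
    (n : ℝ) ^ 2 ≤ 3 * ((shell n e j : ℝ) + 1) * pathEnergy n μ j := by
  set T₀ := G n μ (start n M w e ν j, e)
  set T₁ := ∑ i ∈ range (shell n e j), G n μ (base n M w e ν j + tstep (fine n M) e i, e)
  set T₂ := ∑ m ∈ range (shell n e j + 1), G n μ (corner n M w e ν j + tstep (fine n M) ν m, ν)
  set E₁ := ∑ i ∈ range (shell n e j), ‖G n μ (base n M w e ν j + tstep (fine n M) e i, e)‖ ^ 2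
  set E₂ := ∑ m ∈ range (shell n e j + 1), ‖G n μ (corner n M w e ν j + tstep (fine n M) ν m, ν)‖ ^ 2
  have hsum : T₀ + T₁ + T₂ = (n : ℂ) := path_sum_eq n hMe hMν hne μ j
  have hn : ‖T₀ + T₁ + T₂‖ ^ 2 = (n : ℝ) ^ 2 := by rw [hsum, Complex.norm_natCast]
  have h1 : ‖T₁‖ ^ 2 ≤ (shell n e j : ℝ) * E₁ := norm_sum_range_sq_le _ _
  have h2 : ‖T₂‖ ^ 2 ≤ ((shell n e j + 1 : ℕ) : ℝ) * E₂ := norm_sum_range_sq_le _ _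
  have hE₁ : 0 ≤ E₁ := sum_nonneg fun _ _ => by positivity
  have hE₂ : 0 ≤ E₂ := sum_nonneg fun _ _ => by positivity
  -- `‖a + b + c‖² ≤ 3(‖a‖² + ‖b‖² + ‖c‖²)` (inlined; the tree's copy lives in an unrelated sieve-theory module)
  have h3 : ‖T₀ + T₁ + T₂‖ ^ 2 ≤ 3 * (‖T₀‖ ^ 2 + ‖T₁‖ ^ 2 + ‖T₂‖ ^ 2) := by
    have h := norm_add₃_le (a := T₀) (b := T₁) (c := T₂)
    nlinarith [norm_nonneg (T₀ + T₁ + T₂), norm_nonneg T₀, norm_nonneg T₁, norm_nonneg T₂, sq_nonneg (‖T₀‖ - ‖T₁‖),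
      sq_nonneg (‖T₁‖ - ‖T₂‖), sq_nonneg (‖T₀‖ - ‖T₂‖)]
  have hr0 : (0 : ℝ) ≤ shell n e j := Nat.cast_nonneg _
  have hPE : pathEnergy n μ j = ‖T₀‖ ^ 2 + E₁ + E₂ := rfl
  rw [hPE, ← hn]
  push_cast at h2
  nlinarith [norm_nonneg T₀]

end Summit.QuantumFields.BalabanUV.T4Continuum.RegionGaugeCheckerboardPaths

end
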